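import Literature.AlgebraicGeometry.RelativeSpec.PullbackIsoDiscrepancy
import HarnessLib

/-!
# Discrepancies of `p^* F₁ ≅ p^* F₀`: junctions over a variable action (descent to the base, restriction, comparison)

Layer `Literature/AlgebraicGeometry/RelativeSpec`, namespace `Literature.AlgebraicGeometry.RelativeSpec.ActionOver`.
THEOREMS ONLY; no definition, no named fact, no instance, no notation, no `sorry`.  Sequel to ★ `RelativeSpec/PullbackIsoDiscrepancy`
([MumfordAV1970] §12 Thm. 1; the discrepancy `r_g` of an isomorphism `e : p^* F₁ ≅ p^* F₀` against the canonical linearisations):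
three junctions stated for a VARIABLE action `ρ` so that their instantiation at a concrete action (whose automorphisms are long
composites, e.g. the translation action ★ `translationActionOverWhiskerRight`) is a syntactic match (the known `whnf` cliff).

* **`exists_hom_discrepancy_eq_appTop`** — if `π : X → T` is fixed by the action with `π^♯` bijective on global sections (STEIN) and `G`
  is killed by `n`, the discrepancies are `π^♯(v g)` for a monoid homomorphism `v : G →* Γ(T, 𝒪)` with `(v g)ⁿ = 1` (★
  `existsUnique_discrepancy`, `discrepancy_mul`, `discrepancy_one`);
* **`nonempty_pullback_iso_of_discrepancy_appTop_eq_one`** — along an equivariant square `iX ≫ p = p′ ≫ κ` whose bottom `p′` is an affine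
  flat geometric quotient by a free action, if the discrepancies pull back to `1` along `iX` then `κ^* F₁ ≅ κ^* F₀` (★
  `discrepancy_restrict` + ★ `exists_iso_of_discrepancy_eq_one`);
* **`nonempty_pullback_iso_of_discrepancy_appTop_eq`** — same square, two isomorphisms `e : p^*F₁ ≅ p^*F₀`, `e′ : p^*F₂ ≅ p^*F₀` whose
  discrepancies have the same pull-backs along `iX`: then `κ^* F₁ ≅ κ^* F₂` (★ `discrepancy_restrict` ×2 + ★ `exists_iso_of_discrepancy_eq`).

Cell `hodgecm-mathlib`, HECKE-LINK socket (B) file (ii), D6 brick (u1)+(u2) «EXISTENCE half of the universal property of the dual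
pair of `A/K`» (B-plan1 (g14) 2026-08-29; design review B-p20 (g9); generic engine ★ `RelativeSpec/PullbackIsoDiscrepancy`, B-p07 (g14)).
HC_CM is proved only modulo the 7 printed citations until rung 0 closes; nothing here is about HC.

## References
* [MumfordAV1970] D. Mumford, *Abelian Varieties* (1970), §7 Prop. 2 (p. 70), §12 Thm. 1 (p. 112).
* [MumfordFogartyKirwan1994] D. Mumford, J. Fogarty, F. Kirwan, *GIT*, 3rd ed., Ch. 1 §3 Def. 1.6 (p. 30).
* [Greither1992CyclicGalois] C. Greither, LNM 1534 (1992), Ch. 0 Prop. 7.2 (p. 29).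
-/

set_option autoImplicit false

noncomputable section

-- `TopCat.Presheaf`/`Scheme.Modules` are not reducible (as in Mathlib's `AlgebraicGeometry/Modules`).
set_option backward.isDefEq.respectTransparency false

universe u

open CategoryTheory Limits AlgebraicGeometry TopologicalSpace Opposite
open Literature.AlgebraicGeometry.Modules Literature.AlgebraicGeometry.Motives

namespace Literature.AlgebraicGeometry.RelativeSpec.ActionOver

/-! ## Junctions over a VARIABLE action -/

section GenericHom

variable {X Q T : Scheme.{u}} {p : X ⟶ Q} {G : Type u} [Group G] (ρ : ActionOver p G)

/-- **Invariant discrepancies as a homomorphism to the base.**  Let `π : X → T` be fixed by the action (`σ_g ≫ π = π`) with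
`π^♯ : Γ(T, 𝒪) → Γ(X, 𝒪)` bijective (STEIN), `G` killed by `n`, and `e : p^* F₁ ≅ p^* F₀` with `p^* F₀` a line bundle.  Then the
discrepancies of `e` (★ `existsUnique_discrepancy`) are `π^♯(v g)` for a monoid homomorphism `v : G →* Γ(T, 𝒪)` (they descend
through `π^♯`, are then `G`-invariant, hence multiplicative by ★ `discrepancy_mul`/`discrepancy_one`) with `(v g)ⁿ = 1`.
[cite: MumfordAV1970, §12 Thm. 1 (p. 112)] [cite: MumfordFogartyKirwan1994, Ch. 1 §3 Definition 1.6 (p. 30)] -/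
theorem exists_hom_discrepancy_eq_appTop (π : X ⟶ T) (hπ : ∀ g : G, ρ.autHom g ≫ π = π)
    (hbij : Function.Bijective π.appTop) {n : ℕ} (hn : ∀ g : G, g ^ n = 1) (F₀ F₁ : Q.Modules)
    (h₀ : HasRank ((Scheme.Modules.pullback p).obj F₀) 1)
    (e : (Scheme.Modules.pullback p).obj F₁ ≅ (Scheme.Modules.pullback p).obj F₀) :
    ∃ v : G →* Γ(T, ⊤), (∀ g : G, v g ^ n = 1) ∧ ∀ g : G,
      (Scheme.Modules.pullback (ρ.autHom g)).map e.hom ≫ ((EquivariantStructure.ofPullback ρ F₀).iso g).hom =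
        ((EquivariantStructure.ofPullback ρ F₁).iso g).hom ≫ e.hom ≫
          globalScalar ((Scheme.Modules.pullback p).obj F₀) (π.appTop (v g)) := by
  -- the discrepancy scalars on `X`
  have hex := fun g : G => existsUnique_discrepancy ρ F₀ F₁ e h₀ g
  choose r hr _ using hex
  -- they descend to `T`
  choose v hv using fun g : G => hbij.2 (r g)
  -- invariance (the `σ_g` are `T`-morphisms), hence multiplicativity
  have hinv : ∀ g h : G, (ρ.autHom h).appTop (r g) = r g := by
    intro g h
    rw [← hv g]
    change (π.appTop ≫ (ρ.autHom h).appTop) (v g) = _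
    rw [← Scheme.Hom.comp_appTop, hπ]
  have hmul : ∀ g h : G, r (g * h) = r g * r h := fun g h => discrepancy_mul ρ F₀ F₁ e h₀ r hr hinv g h
  have hone : r 1 = 1 := discrepancy_one ρ F₀ F₁ e h₀ r hr
  have hvmul : ∀ g h : G, v (g * h) = v g * v h := fun g h => hbij.1 (by rw [map_mul, hv, hv, hv, hmul])
  have hvone : v 1 = 1 := hbij.1 (by rw [map_one, hv, hone])
  let vh : G →* Γ(T, ⊤) := { toFun := v, map_one' := hvone, map_mul' := hvmul }
  have hvh : ∀ g, vh g = v g := fun g => rfl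
  refine ⟨vh, fun g => ?_, fun g => ?_⟩
  · rw [← map_pow vh, hn, map_one]
  · rw [hvh, hv]
    exact hr g

end GenericHom

section GenericRestrict

variable {X X' Q Q' : Scheme.{u}} {p : X ⟶ Q} {p' : X' ⟶ Q'} {G : Type u} [Group G]
  (ρ : ActionOver p G) (τ : ActionOver p' G) (iX : X' ⟶ X) (κ : Q' ⟶ Q) (hsq : iX ≫ p = p' ≫ κ)
  (hι : ∀ g : G, τ.autHom g ≫ iX = iX ≫ ρ.autHom g)

include hsq hι in
/-- **Restriction to where the discrepancies die.**  Along an equivariant square `iX ≫ p = p′ ≫ κ` (`τ_g ≫ iX = iX ≫ σ_g`) whose bottom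
`p′` is an affine flat geometric quotient by a free action, if the discrepancies `r g` of `e : p^* F₁ ≅ p^* F₀` (line bundles
`Fᵢ`) pull back to `1` along `iX`, then `κ^* F₁ ≅ κ^* F₀`: the restricted isomorphism has discrepancies `iX^♯(r g) = 1` (★
`discrepancy_restrict`) and descends (★ `exists_iso_of_discrepancy_eq_one`). [cite: MumfordAV1970, §12 Thm. 1 (p. 112)]
[cite: Greither1992CyclicGalois, Ch. 0 Prop. 7.2 (p. 29)] -/
theorem nonempty_pullback_iso_of_discrepancy_appTop_eq_one [Fintype G] [IsAffineHom p'] [Flat p'] (hq' : τ.IsGeometricQuotient p')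
    (hfree' : ∀ (V : Q'.Opens), IsAffineOpen V → ∀ g : G, g ≠ 1 →
      Ideal.span (Set.range fun b : Γ(X', p' ⁻¹ᵁ V) ↦ τ.act g V b - b) = ⊤)
    (F₀ F₁ : Q.Modules) (h₀ : HasRank F₀ 1) (h₁ : HasRank F₁ 1)
    (e : (Scheme.Modules.pullback p).obj F₁ ≅ (Scheme.Modules.pullback p).obj F₀) (r : G → Γ(X, ⊤))
    (he : ∀ g : G, (Scheme.Modules.pullback (ρ.autHom g)).map e.hom ≫ ((EquivariantStructure.ofPullback ρ F₀).iso g).hom =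
      ((EquivariantStructure.ofPullback ρ F₁).iso g).hom ≫ e.hom ≫ globalScalar ((Scheme.Modules.pullback p).obj F₀) (r g))
    (hr1 : ∀ g : G, iX.appTop (r g) = 1) :
    Nonempty ((Scheme.Modules.pullback κ).obj F₁ ≅ (Scheme.Modules.pullback κ).obj F₀) := by
  let eG : (Scheme.Modules.pullback p').obj ((Scheme.Modules.pullback κ).obj F₁) ≅
      (Scheme.Modules.pullback p').obj ((Scheme.Modules.pullback κ).obj F₀) :=
    (squareIso hsq F₁).symm ≪≫ (Scheme.Modules.pullback iX).mapIso e ≪≫ squareIso hsq F₀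
  have heG : ∀ g : G, (Scheme.Modules.pullback (τ.autHom g)).map eG.hom ≫
      ((EquivariantStructure.ofPullback τ ((Scheme.Modules.pullback κ).obj F₀)).iso g).hom =
      ((EquivariantStructure.ofPullback τ ((Scheme.Modules.pullback κ).obj F₁)).iso g).hom ≫ eG.hom ≫
        globalScalar ((Scheme.Modules.pullback p').obj ((Scheme.Modules.pullback κ).obj F₀)) 1 := by
    intro g
    have h := discrepancy_restrict ρ τ iX κ hsq hι F₀ F₁ h₀ h₁ e r he g
    rw [hr1] at h
    exact h
  haveI : ((Scheme.Modules.pullback κ).obj F₀).IsQuasicoherent := isQuasicoherent_of_hasRank (hasRank_pullback κ h₀)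
  obtain ⟨i, -⟩ := exists_iso_of_discrepancy_eq_one τ ((Scheme.Modules.pullback κ).obj F₀)
    ((Scheme.Modules.pullback κ).obj F₁) eG hq' hfree' heG
  exact ⟨i⟩

include hsq hι in
/-- **Equal restricted discrepancies ⇒ the restricted modules agree.**  Along an equivariant square as above, two isomorphisms
`e : p^* F₁ ≅ p^* F₀`, `e′ : p^* F₂ ≅ p^* F₀` (line bundles) whose discrepancies `r g`, `r′ g` have THE SAME pull-backs along `iX`
give `κ^* F₁ ≅ κ^* F₂` (★ `discrepancy_restrict` twice, then ★ `exists_iso_of_discrepancy_eq` over the free quotient `p′`).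
[cite: MumfordAV1970, §12 Thm. 1 (p. 112)] [cite: Greither1992CyclicGalois, Ch. 0 Prop. 7.2 (p. 29)] -/
theorem nonempty_pullback_iso_of_discrepancy_appTop_eq [Fintype G] [IsAffineHom p'] [Flat p'] (hq' : τ.IsGeometricQuotient p')
    (hfree' : ∀ (V : Q'.Opens), IsAffineOpen V → ∀ g : G, g ≠ 1 →
      Ideal.span (Set.range fun b : Γ(X', p' ⁻¹ᵁ V) ↦ τ.act g V b - b) = ⊤)
    (F₀ F₁ F₂ : Q.Modules) (h₀ : HasRank F₀ 1) (h₁ : HasRank F₁ 1) (h₂ : HasRank F₂ 1)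
    (e : (Scheme.Modules.pullback p).obj F₁ ≅ (Scheme.Modules.pullback p).obj F₀)
    (e' : (Scheme.Modules.pullback p).obj F₂ ≅ (Scheme.Modules.pullback p).obj F₀) (r r' : G → Γ(X, ⊤))
    (he : ∀ g : G, (Scheme.Modules.pullback (ρ.autHom g)).map e.hom ≫ ((EquivariantStructure.ofPullback ρ F₀).iso g).hom =
      ((EquivariantStructure.ofPullback ρ F₁).iso g).hom ≫ e.hom ≫ globalScalar ((Scheme.Modules.pullback p).obj F₀) (r g))
    (he' : ∀ g : G, (Scheme.Modules.pullback (ρ.autHom g)).map e'.hom ≫ ((EquivariantStructure.ofPullback ρ F₀).iso g).hom =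
      ((EquivariantStructure.ofPullback ρ F₂).iso g).hom ≫ e'.hom ≫ globalScalar ((Scheme.Modules.pullback p).obj F₀) (r' g))
    (hrr : ∀ g : G, iX.appTop (r g) = iX.appTop (r' g)) :
    Nonempty ((Scheme.Modules.pullback κ).obj F₁ ≅ (Scheme.Modules.pullback κ).obj F₂) := by
  have hd := discrepancy_restrict ρ τ iX κ hsq hι F₀ F₁ h₀ h₁ e r he
  have hd' := discrepancy_restrict ρ τ iX κ hsq hι F₀ F₂ h₀ h₂ e' r' he'
  haveI : ((Scheme.Modules.pullback κ).obj F₀).IsQuasicoherent := isQuasicoherent_of_hasRank (hasRank_pullback κ h₀)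
  obtain ⟨i, -⟩ := exists_iso_of_discrepancy_eq τ ((Scheme.Modules.pullback κ).obj F₀) ((Scheme.Modules.pullback κ).obj F₁)
    ((Scheme.Modules.pullback κ).obj F₂)
    ((squareIso hsq F₁).symm ≪≫ (Scheme.Modules.pullback iX).mapIso e ≪≫ squareIso hsq F₀)
    ((squareIso hsq F₂).symm ≪≫ (Scheme.Modules.pullback iX).mapIso e' ≪≫ squareIso hsq F₀) hq' hfree'
    (fun g => iX.appTop (r g)) hd (fun g => by rw [hrr g]; exact hd' g)
  exact ⟨i⟩

end GenericRestrict

end Literature.AlgebraicGeometry.RelativeSpec.ActionOver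

end
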